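import Literature.Barriers.ValiantsHypothesis.GCTMatrixPoweringProp17OnlyIf
import Literature.RepresentationTheory.FiniteGroups.SymmetricGroupSquareEvaluation
import HarnessLib

/-!
# Gesmundo–Ikenmeyer–Panova 2017, §3: deciding `sk(λ, μ) > 0`, `ak(λ, μ) > 0` in the kernel
# (certificates for the 64 atoms of Prop. 18)

Sibling proofs file (D-0014; theorems only) of `GCTMatrixPowering.lean` (`skCharSum`, `SkPos`,
`SmPos`), `GCTMatrixPoweringColumns.lean` (`akCharSum`, `AkPos`, `AmPos`, `ofColumns`, `colCount`)
and `GCTMatrixPoweringProp18.lean` (`GIP2017_prop18_corrected_of_atoms`: the corrected Prop. 18,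
hence Prop. 20 corrected and the barrier `GCTMatrixPowering`, from 64 explicit small `sm`/`am`
positivity statements, the "atoms"). It connects the tree's character-sum rendering of GIP's
symmetric and skew Kronecker coefficients,

  `skCharSum λ μ = Σ_σ χ^λ(σ)(χ^μ(σ)² + χ^μ(σ²)) = 2·D!·sk(λ, μ)`,
  `akCharSum λ μ = Σ_σ χ^λ(σ)(χ^μ(σ)² - χ^μ(σ²)) = 2·D!·ak(λ, μ)`

(GIP §2.1, §3; Fulton–Harris §2.1), with the verified evaluators `MNEval.skSumT`, `MNEval.akSumT`
of `Literature/RepresentationTheory/FiniteGroups/SymmetricGroupSquareEvaluation.lean` (which take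
the first partition through its transpose `λᵗ`, i.e. for a shape given by its columns `S` through
the decreasing list of `S`): `skCharSum_eq_skSumT`, `akCharSum_eq_akSumT`, so that `SkPos λ μ` /
`AkPos λ μ` become DECIDABLE on closed instances (`skPos_iff_skSumT_ne_zero`,
`akPos_iff_akSumT_ne_zero`; `decide`).
This is what replaces the one non-formalizable ingredient of GIP's proof of Prop. 20 — Prop. 18,
"a direct computation" with "a program written by Harm Derksen and adjusted by Jesko Hüttenhain" —
by kernel computations of its 64 atoms (sibling files `GCTMatrixPoweringAtomsA–J.lean`, assembled
in `GCTMatrixPoweringErratumProofs.lean`).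

Also here (§2): explicit partitions from decreasing lists (`sortedParts_ofSums_coe`), the rows and
the columns of `ofColumns S` as explicit lists (`sortedParts_ofColumns_eq`,
`sortedParts_transpose_ofColumns_eq`), giving the one-line certificates `smPos_ofColumns_of_skSumT`
/ `amPos_ofColumns_of_akSumT` ("`sm(λ, m) > 0` because `sk(λ, μ) ≠ 0` for this explicit `μ` with at
most `m` rows, by `decide`").

## References

* [GesmundoIkenmeyerPanova2017] F. Gesmundo, C. Ikenmeyer, G. Panova, *Geometric complexity
  theory and matrix powering*, Diff. Geom. Appl. 55 (2017) 106–127 = arXiv:1611.00827, §2.1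
  (`sk`), §3 (`ak`, (3.1), Prop. 15, Prop. 18, proof of Prop. 20; held text pp. 9–12).
* [FultonHarrisGTM129] W. Fulton, J. Harris, *Representation Theory. A First Course*, GTM 129
  (1991), §2.1 (characters of `Sym²`, `Λ²`), Exercise 4.51.
-/

noncomputable section

open scoped BigOperators

namespace Literature.Barriers.ValiantsHypothesis

open Literature.NumberTheory.DiophantineGeometry Literature.Computability.Complexity
open Literature.RepresentationTheory.FiniteGroups
open Literature.RepresentationTheory.FiniteGroups.MNEval (skSumT akSumT skTerm akTerm charValue cycleTypes)

/-! ### 1. `sk`, `ak` through the verified evaluator -/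

section Eval

variable {n : ℕ}

/-- **`skCharSum` is computed by the evaluator**: `skCharSum λ μ = skSumT n λᵗ μ`
(`= 2·n!·sk(λ, μ)`). [cite: GesmundoIkenmeyerPanova2017, §2.1 (sk)] [cite: FultonHarrisGTM129, §2.1 (character of Sym²)] -/
theorem skCharSum_eq_skSumT (lam mu : Nat.Partition n) :
    skCharSum lam mu = (skSumT n lam.transpose.sortedParts mu.sortedParts : ℂ) :=
  MNEval.sum_symSq_eq_skSumT lam mu

/-- **`akCharSum` is computed by the evaluator**: `akCharSum λ μ = akSumT n λᵗ μ`
(`= 2·n!·ak(λ, μ)`). [cite: GesmundoIkenmeyerPanova2017, §3 (ak)] [cite: FultonHarrisGTM129, §2.1 (character of Λ²)] -/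
theorem akCharSum_eq_akSumT (lam mu : Nat.Partition n) :
    akCharSum lam mu = (akSumT n lam.transpose.sortedParts mu.sortedParts : ℂ) :=
  MNEval.sum_extSq_eq_akSumT lam mu

/-- **Positivity test for `sk`**: `SkPos λ μ ↔ skSumT n λᵗ μ ≠ 0` (decidable by `decide` on closed
instances). [cite: GesmundoIkenmeyerPanova2017, §2.1 (sk)] -/
theorem skPos_iff_skSumT_ne_zero (lam mu : Nat.Partition n) :
    SkPos lam mu ↔ skSumT n lam.transpose.sortedParts mu.sortedParts ≠ 0 := by
  rw [SkPos, skCharSum_eq_skSumT, Int.cast_ne_zero]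

/-- **Positivity test for `ak`**: `AkPos λ μ ↔ akSumT n λᵗ μ ≠ 0`.
[cite: GesmundoIkenmeyerPanova2017, §3 (ak)] -/
theorem akPos_iff_akSumT_ne_zero (lam mu : Nat.Partition n) :
    AkPos lam mu ↔ akSumT n lam.transpose.sortedParts mu.sortedParts ≠ 0 := by
  rw [AkPos, akCharSum_eq_akSumT, Int.cast_ne_zero]

end Eval

/-! ### 2. Explicit partitions and the rows of `ofColumns S` -/

section Explicit

/-- A list of positive naturals has no zero to filter out. [folklore] -/
theorem filter_ne_zero_coe_eq {M : List ℕ} (h : ∀ x ∈ M, 0 < x) :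
    (M : Multiset ℕ).filter (· ≠ 0) = (M : Multiset ℕ) :=
  Multiset.filter_eq_self.2 fun x hx => (h x (Multiset.mem_coe.1 hx)).ne'

/-- The parts of the partition with prescribed positive parts `M`. [folklore] -/
theorem parts_ofSums_coe {n : ℕ} {M : List ℕ} (hs : (M : Multiset ℕ).sum = n)
    (hpos : ∀ x ∈ M, 0 < x) : (Nat.Partition.ofSums n (M : Multiset ℕ) hs).parts = (M : Multiset ℕ) := by
  change (M : Multiset ℕ).filter (· ≠ 0) = _
  exact filter_ne_zero_coe_eq hpos

/-- The sorted parts of the partition with prescribed decreasing positive parts `M` are `M`.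
[folklore] -/
theorem sortedParts_ofSums_coe {n : ℕ} {M : List ℕ} (hs : (M : Multiset ℕ).sum = n)
    (hM : M.Pairwise (· ≥ ·)) (hpos : ∀ x ∈ M, 0 < x) :
    (Nat.Partition.ofSums n (M : Multiset ℕ) hs).sortedParts = M := by
  change (Nat.Partition.ofSums n (M : Multiset ℕ) hs).parts.sort (· ≥ ·) = M
  rw [parts_ofSums_coe hs hpos, Multiset.coe_sort]
  exact List.mergeSort_eq_self _ hM

/-- Such a partition has `|M|` parts. [folklore] -/
theorem card_parts_ofSums_coe {n : ℕ} {M : List ℕ} (hs : (M : Multiset ℕ).sum = n)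
    (hpos : ∀ x ∈ M, 0 < x) : (Nat.Partition.ofSums n (M : Multiset ℕ) hs).parts.card = M.length := by
  rw [parts_ofSums_coe hs hpos, Multiset.coe_card]

/-- **The rows of `ofColumns S` as an explicit list**: if `L` has length `max S` and
`L_r = #{c ∈ S : c > r}` for `r < max S` (a finite, decidable check), then
`(ofColumns S).sortedParts = L`. [cite: GesmundoIkenmeyerPanova2017, §3 (proof of Prop. 20: shapes from their columns)] -/
theorem sortedParts_ofColumns_eq {S : Multiset ℕ} {L : List ℕ}
    (h : L.length = S.sup ∧ ∀ r ∈ List.range S.sup, L.getD r 0 = colCount S r) :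
    (ofColumns S).sortedParts = L := by
  obtain ⟨hlen, hrows⟩ := h
  refine List.ext_getElem ?_ fun i h1 h2 => ?_
  · rw [Nat.Partition.length_sortedParts, card_parts_ofColumns, hlen]
  · have hi : i < S.sup := hlen ▸ h2
    have e1 := getD_sortedParts_ofColumns S i
    rw [List.getD_eq_getElem _ _ h1] at e1
    have e2 := hrows i (List.mem_range.2 hi)
    rw [List.getD_eq_getElem _ _ h2] at e2
    rw [e1, ← e2]

/-- The parts of `ofColumns S` as an explicit multiset, from its rows. [folklore] -/
theorem parts_ofColumns_eq {S : Multiset ℕ} {L : List ℕ}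
    (h : L.length = S.sup ∧ ∀ r ∈ List.range S.sup, L.getD r 0 = colCount S r) :
    (ofColumns S).parts = (L : Multiset ℕ) := by
  rw [← sortedParts_ofColumns_eq h]
  exact (Multiset.sort_eq _ _).symm

/-- **The columns of `ofColumns S` as an explicit list** (the decreasing list of `S` when `S` has no
zeros): if `Lt` has length `max L` and `Lt_r = #{x ∈ L : x > r}` for `r < max L`, `L` the rows, then
`(ofColumns S)ᵗ.sortedParts = Lt` (rows of the transpose count the rows longer than `r`,
`getD_sortedParts_transpose_eq_colCount`). [cite: GesmundoIkenmeyerPanova2017, §3 (λᵗ, before Thm. 16)] -/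
theorem sortedParts_transpose_ofColumns_eq {S : Multiset ℕ} {L Lt : List ℕ}
    (hL : L.length = S.sup ∧ ∀ r ∈ List.range S.sup, L.getD r 0 = colCount S r)
    (hLt : Lt.length = (L : Multiset ℕ).sup ∧
      ∀ r ∈ List.range (L : Multiset ℕ).sup, Lt.getD r 0 = colCount (L : Multiset ℕ) r) :
    (ofColumns S).transpose.sortedParts = Lt := by
  obtain ⟨hlen, hrows⟩ := hLt
  have hparts := parts_ofColumns_eq hL
  refine List.ext_getElem ?_ fun i h1 h2 => ?_
  · rw [Nat.Partition.length_sortedParts, ← sup_parts_eq_card_transpose, hparts, hlen]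
  · have hi : i < (L : Multiset ℕ).sup := hlen ▸ h2
    have e1 := getD_sortedParts_transpose_eq_colCount (ofColumns S) i
    rw [List.getD_eq_getElem _ _ h1, hparts] at e1
    have e2 := hrows i (List.mem_range.2 hi)
    rw [List.getD_eq_getElem _ _ h2] at e2
    rw [e1, ← e2]

/-- **Certificate of `sm(λ, m) > 0` for the shape with columns `S`**: an explicit `μ ⊢ |λ|` with at
most `m` rows (decreasing positive parts `M`) and `2·n!·sk(λ, μ) = skSumT n Lt M ≠ 0`, `n = |λ|`,
`L` the rows and `Lt` the columns of `λ` — the last hypothesis is what `decide` establishes in the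
kernel; the others are finite checks on explicit lists. [cite: GesmundoIkenmeyerPanova2017, §3 (Prop. 18: "a direct computation")] -/
theorem smPos_ofColumns_of_skSumT (S : Multiset ℕ) (n : ℕ) (L Lt M : List ℕ) {m : ℕ}
    (hn : S.sum = n)
    (hL : L.length = S.sup ∧ ∀ r ∈ List.range S.sup, L.getD r 0 = colCount S r)
    (hLt : Lt.length = (L : Multiset ℕ).sup ∧
      ∀ r ∈ List.range (L : Multiset ℕ).sup, Lt.getD r 0 = colCount (L : Multiset ℕ) r)
    (hM : M.Pairwise (· ≥ ·) ∧ (∀ x ∈ M, 0 < x) ∧ M.sum = n ∧ M.length ≤ m)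
    (h : skSumT n Lt M ≠ 0) : SmPos m (ofColumns S) := by
  obtain ⟨hM1, hM2, hM3, hM4⟩ := hM
  have hs : (M : Multiset ℕ).sum = S.sum := by rw [Multiset.sum_coe, hM3, hn]
  refine ⟨Nat.Partition.ofSums S.sum (M : Multiset ℕ) hs, ?_, ?_⟩
  · rw [card_parts_ofSums_coe hs hM2]
    exact hM4
  · rw [skPos_iff_skSumT_ne_zero, sortedParts_transpose_ofColumns_eq hL hLt,
      sortedParts_ofSums_coe hs hM1 hM2, hn]
    exact h

/-- **Certificate of `am(λ, m) > 0` for the shape with columns `S`** (skew twin of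
`smPos_ofColumns_of_skSumT`). [cite: GesmundoIkenmeyerPanova2017, §3 (Prop. 18: "a direct computation")] -/
theorem amPos_ofColumns_of_akSumT (S : Multiset ℕ) (n : ℕ) (L Lt M : List ℕ) {m : ℕ}
    (hn : S.sum = n)
    (hL : L.length = S.sup ∧ ∀ r ∈ List.range S.sup, L.getD r 0 = colCount S r)
    (hLt : Lt.length = (L : Multiset ℕ).sup ∧
      ∀ r ∈ List.range (L : Multiset ℕ).sup, Lt.getD r 0 = colCount (L : Multiset ℕ) r)
    (hM : M.Pairwise (· ≥ ·) ∧ (∀ x ∈ M, 0 < x) ∧ M.sum = n ∧ M.length ≤ m)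
    (h : akSumT n Lt M ≠ 0) : AmPos m (ofColumns S) := by
  obtain ⟨hM1, hM2, hM3, hM4⟩ := hM
  have hs : (M : Multiset ℕ).sum = S.sum := by rw [Multiset.sum_coe, hM3, hn]
  refine ⟨Nat.Partition.ofSums S.sum (M : Multiset ℕ) hs, ?_, ?_⟩
  · rw [card_parts_ofSums_coe hs hM2]
    exact hM4
  · rw [akPos_iff_akSumT_ne_zero, sortedParts_transpose_ofColumns_eq hL hLt,
      sortedParts_ofSums_coe hs hM1 hM2, hn]
    exact h

end Explicit

end Literature.Barriers.ValiantsHypothesis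

end
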